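import Summits.QuantumFields.YangMills.Theorems.BalabanLadderNTMarkovMirrorReflect
import Summits.QuantumFields.YangMills.Theorems.BalabanLadderNTReflectionCauchySchwarzPos
import HarnessLib

/-!
# Crux `NT` (stmt-QuantumFields-19353) / `UVSeamRec.stub_floorsEngine` (stmt-QuantumFields-20043):
# the mirror floor transfer of card `markov-mirror-dirichlet-response` (composition, per coupling and torus)

Third file of the Markov–mirror series (fleet lead prover of crux `UVSeamRec`, unit `ym-spine-20043-p1`, g6).  The
card's composition (its sorried `lowerBounds_fst_of_mmf`, Mechanism 5) at ONE coupling `β ≥ 0` on ONE odd torus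
`2L+1`, with every hypothesis explicit and no package definition:

given a cube `Q = (c, b)` at times `≥ 1`, a bounded continuous cylinder observable `W` carried by `Q` (the smeared
action density `Ṽ_v` in the application), a reference value `p`, a bounded continuous cylinder «shell functional»
`𝒢` on the closed collar of `Q`, and `ε > 0` with
* (RBL + SUP) `|kerE_Q^ζ(W) − p + 𝒢 ζ| ≤ √ε / 2` for EVERY exterior `ζ` (the refined boundary law to relative leading
  order, with its error already capped at half the floor scale), and
* (SF) `Cov_T(𝒢∘Θ₀, 𝒢) ≥ 4ε` on this torus (the shell floor),
then `Cov_T(W∘Θ₀, W) ≥ 9ε/4` (`mirrorCov_ge_of_boundaryResponse`).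

Proof = the card's three lines of Hilbert-space geometry, kernel-checked: (1) the mirror factorisation
`Cov_T(W∘Θ₀, W) = B(m, m)`, `m = kerE_Q(W)∘lift`, `B(X, Y) = Cov_T(X∘ϑ, Y)` (`torusCov_reflect_lift_eq_torusCov_reflect_kerE`);
(2) `m − p = −𝒢̃ + d` with `sup |d| ≤ √ε/2`, so `B(m,m) = B(𝒢̃,𝒢̃) − 2B(𝒢̃,d) + B(d,d)` (constants have seminorm 0;
`ϑ`-invariance makes `B` symmetric); (3) reflection-positivity Cauchy–Schwarz `B(𝒢̃,d)² ≤ B(𝒢̃,𝒢̃)·B(d,d)` (tree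
`Reflection.sq_cov_negReflect_le_odd_pos`, p-landed by the 19353 lead g3) and `B(d,d) ≤ ∫|d∘ϑ||d| ≤ ε/4`, whence
`B(m,m) ≥ (√B(𝒢̃,𝒢̃) − √B(d,d))² ≥ (2√ε − √ε/2)² = 9ε/4` (`mirror_floor_arith`; positivity of `B(d,d)` comes for free
from Cauchy–Schwarz against the strictly positive `B(𝒢̃,𝒢̃)`).

* §1 torus-side bookkeeping: `dependsOn_comp_torusLift`, `torusEdge_mem_posHalf`, `dependsOn_posHalf_of_window`;
* §2 `mirror_floor_arith` (scalar reverse triangle inequality);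
* §3 `mirrorCov_ge_of_boundaryResponse`.

The asymptotic packaging (families `Q_β`, `p β`, `𝒢_β`; `ShiftCeiling`; clause (i) of `LowerBounds` on all tori with
`a(β)·L ≥ Λ₅`; `NT` by name) is the next file.  Refs: crux idea `Cruxes/NT/Ideas/markov-mirror-dirichlet-response.md`
(Mechanism 1–5; Sketch §E `sq_sqrt_sub_sqrt_le`, `lowerBounds_fst_of_mmf`); Osterwalder–Seiler 1978 §2;
Fröhlich–Israel–Lieb–Simon 1978 Thm 2.1; Glimm–Jaffe 1987 §6.1.
-/

set_option autoImplicit false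

noncomputable section

open MeasureTheory Filter Topology
open Literature.MathematicalPhysics.QuantumFieldTheory Literature.MathematicalPhysics.QuantumLattice
open Literature.Probability.LatticeModels
open Summit.QuantumFields.YangMills.Cruxes.OSLegsFromFemtoAndGap.DlrCollarTransfer
open Summit.QuantumFields.YangMills.Cruxes.NT.Reference (continuous_kerE continuous_kerE_torusLift abs_mul_le_of_abs_le)
open Summit.QuantumFields.YangMills.Cruxes.NT.BoundaryLaw (abs_kerE_le)
open Summit.QuantumFields.YangMills.Cruxes.NT.Reflection (sq_cov_negReflect_le_odd_pos integrable_wilson_of_bdd)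

namespace Summit.QuantumFields.YangMills.Cruxes.NT.MarkovMirror

/-! ## §1 Torus-side bookkeeping: lifted cylinders live on the links below their support -/

section Torus

variable {G : Type} [Group G]

omit [Group G] in
/-- A cylinder observable of `ℤ⁴` read through the periodic lift depends only on the torus links below its support.
[folklore] -/
theorem dependsOn_comp_torusLift (T : ℕ) {α : Type*} {H : LGConfig 4 G → α}
    {S : Finset (Literature.MathematicalPhysics.QuantumLattice.ZdEdge 4)} (hH : IsCylinder H S) :
    DependsOn (fun U : GaugeConfig 4 T G => H (torusLift T U)) ↑(S.image (torusEdge T)) := by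
  classical
  intro U V h
  apply hH
  intro e he
  show U (torusEdge T e) = V (torusEdge T e)
  exact h _ (Finset.mem_coe.2 (Finset.mem_image_of_mem _ (Finset.mem_coe.1 he)))

/-- A link of `ℤ⁴` based at a time `t` with `0 ≤ t`, `t + 1 ≤ S` projects to a link of the closed non-negative half
of the torus of side `2S+1` (both endpoints at times `≤ S`). [folklore] -/
theorem torusEdge_mem_posHalf (S : ℕ) {e : Literature.MathematicalPhysics.QuantumLattice.ZdEdge 4}
    (h0 : 0 ≤ e.1 0) (h1 : e.1 0 + 1 ≤ S) :
    ((torusEdge (2 * S + 1) e).1 0).val ≤ S ∧ (((torusEdge (2 * S + 1) e).1.shift (torusEdge (2 * S + 1) e).2) 0).val ≤ S := by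
  obtain ⟨x, i⟩ := e
  simp only at h0 h1
  obtain ⟨t, ht⟩ := Int.eq_ofNat_of_zero_le h0
  have htS : t + 1 ≤ S := by omega
  have hlt : t < 2 * S + 1 := by omega
  have hlt' : t + 1 < 2 * S + 1 := by omega
  have hval : ((Torus.proj (2 * S + 1) x) 0).val = t := by
    simp only [Torus.proj_apply, ht, Int.cast_natCast, ZMod.val_natCast, Nat.mod_eq_of_lt hlt]
  refine ⟨by simp only [torusEdge]; rw [hval]; omega, ?_⟩
  simp only [torusEdge]
  by_cases hi : i = 0
  · subst hi
    rw [WilsonRP.shift_apply_self]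
    have : ((Torus.proj (2 * S + 1) x) 0 + 1 : ZMod (2 * S + 1)) = ((t + 1 : ℕ) : ZMod (2 * S + 1)) := by
      rw [← ZMod.natCast_zmod_val ((Torus.proj (2 * S + 1) x) 0), hval]; push_cast; ring
    rw [this, ZMod.val_natCast, Nat.mod_eq_of_lt hlt']
    exact htS
  · rw [WilsonRP.shift_apply_of_ne _ (fun h => hi h.symm), hval]
    omega

omit [Group G] in
/-- A cylinder observable whose links are based at times in `[0, S − 1]`, read through the periodic lift of the torus
of side `2S+1`, is an observable of the closed non-negative half (the hypothesis of the tree's reflection-positivity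
Cauchy–Schwarz `sq_cov_negReflect_le_odd_pos`). [folklore] -/
theorem dependsOn_posHalf_of_window (S : ℕ) {α : Type*} {H : LGConfig 4 G → α}
    {SH : Finset (Literature.MathematicalPhysics.QuantumLattice.ZdEdge 4)} (hH : IsCylinder H SH)
    (hw : ∀ e ∈ SH, 0 ≤ e.1 0 ∧ e.1 0 + 1 ≤ S) :
    DependsOn (fun U : GaugeConfig 4 (2 * S + 1) G => H (torusLift (2 * S + 1) U))
      {e : Edge 4 (2 * S + 1) | (e.1 0).val ≤ S ∧ ((e.1.shift e.2) 0).val ≤ S} := by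
  classical
  refine (dependsOn_comp_torusLift (2 * S + 1) hH).mono fun e he => ?_
  obtain ⟨e', he', rfl⟩ := Finset.mem_image.1 (Finset.mem_coe.1 he)
  exact torusEdge_mem_posHalf S (hw e' he').1 (hw e' he').2

end Torus

/-! ## §2 The scalar reverse triangle inequality -/

/-- **Reverse triangle inequality of a positive-semidefinite form, scalar shadow** (the card's `sq_sqrt_sub_sqrt_le`
in the shape used here).  If `bmm = bgg − 2 bgd + bdd`, `bgd² ≤ bgg · bdd` (Cauchy–Schwarz), `bgg ≥ 4ε`, `bdd ≤ ε/4`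
and `ε > 0`, then `bmm ≥ 9ε/4`: indeed `bdd ≥ 0` (from Cauchy–Schwarz against `bgg > 0`), so
`bmm ≥ (√bgg − √bdd)² ≥ (2√ε − √ε/2)²`. [folklore] -/
theorem mirror_floor_arith {bmm bgg bgd bdd ε : ℝ} (hm : bmm = bgg - 2 * bgd + bdd) (hcs : bgd ^ 2 ≤ bgg * bdd)
    (hg : 4 * ε ≤ bgg) (hd : bdd ≤ ε / 4) (hε : 0 < ε) : 9 * ε / 4 ≤ bmm := by
  have hgpos : 0 < bgg := by linarith
  have hdnn : 0 ≤ bdd := by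
    by_contra h
    push Not at h
    have : bgg * bdd < 0 := mul_neg_of_pos_of_neg hgpos h
    nlinarith [sq_nonneg bgd]
  set x := Real.sqrt bgg with hx
  set y := Real.sqrt bdd with hy
  have hxx : x ^ 2 = bgg := Real.sq_sqrt hgpos.le
  have hyy : y ^ 2 = bdd := Real.sq_sqrt hdnn
  have hx0 : 0 ≤ x := Real.sqrt_nonneg _
  have hy0 : 0 ≤ y := Real.sqrt_nonneg _
  have hse : Real.sqrt ε ^ 2 = ε := Real.sq_sqrt hε.le
  have hs0 : 0 ≤ Real.sqrt ε := Real.sqrt_nonneg _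
  -- `x ≥ 2√ε`, `y ≤ √ε/2`
  have hx2 : 2 * Real.sqrt ε ≤ x := by
    rw [hx, show 2 * Real.sqrt ε = Real.sqrt (4 * ε) by
      rw [Real.sqrt_mul (by norm_num : (0:ℝ) ≤ 4), show Real.sqrt 4 = 2 by
        rw [show (4:ℝ) = 2 ^ 2 by norm_num, Real.sqrt_sq (by norm_num : (0:ℝ) ≤ 2)]]]
    exact Real.sqrt_le_sqrt hg
  have hy2 : y ≤ Real.sqrt ε / 2 := by
    rw [hy, show Real.sqrt ε / 2 = Real.sqrt (ε / 4) by
      rw [Real.sqrt_div hε.le, show Real.sqrt 4 = 2 by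
        rw [show (4:ℝ) = 2 ^ 2 by norm_num, Real.sqrt_sq (by norm_num : (0:ℝ) ≤ 2)]]]
    exact Real.sqrt_le_sqrt hd
  -- `|bgd| ≤ x y`
  have h1 : |bgd| ≤ x * y := by
    rw [hx, hy, ← Real.sqrt_mul hgpos.le bdd]
    exact Real.abs_le_sqrt hcs
  have h2 : bgd ≤ x * y := (abs_le.1 h1).2
  -- `(x − y)² ≥ (3√ε/2)²`
  have h3 : 3 * Real.sqrt ε / 2 ≤ x - y := by linarith
  have h4 : (3 * Real.sqrt ε / 2) ^ 2 ≤ (x - y) ^ 2 := by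
    have : 0 ≤ 3 * Real.sqrt ε / 2 := by positivity
    exact pow_le_pow_left₀ this h3 2
  nlinarith [hxx, hyy, hse, h2, h4]

/-! ## §3 The mirror form `B(X, Y) = Cov_T(X∘ϑ, Y)`: expansion along `m = D − 𝒢̃ + p` -/

section Form

variable {G : Type} [Group G] [TopologicalSpace G] [IsTopologicalGroup G] [CompactSpace G]
  [MeasurableSpace G] [BorelSpace G] {N T : ℕ} [NeZero T] (ρ : G →* Matrix (Fin N) (Fin N) ℂ)

/-- **Expansion of the mirror form along `m = X − Y + p`.**  On the torus of side `T` with Wilson's measure and the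
site reflection `ϑ = GaugeConfig.negReflect` (measure preserving, an involution), for bounded measurable real `X, Y`
and a constant `p`:
`B(X − Y + p, X − Y + p) = B(Y, Y) − 2 B(Y, X) + B(X, X)`, `B(F, H) := ∫ F∘ϑ · H − ∫F ∫H`
(constants have seminorm zero; `ϑ`-invariance makes `B` symmetric). [folklore] -/
theorem mirrorForm_expand (hρ : Continuous ρ) (β : ℝ) {X Y : GaugeConfig 4 T G → ℝ} (hX : Measurable X)
    (hY : Measurable Y) {MX MY : ℝ} (bX : ∀ U, |X U| ≤ MX) (bY : ∀ U, |Y U| ≤ MY) (p : ℝ) :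
    (∫ U, (X U.negReflect - Y U.negReflect + p) * (X U - Y U + p) ∂(wilsonMeasure ρ β)) -
        (∫ U, (X U - Y U + p) ∂(wilsonMeasure ρ β)) ^ 2 =
      ((∫ U, Y U.negReflect * Y U ∂(wilsonMeasure ρ β)) - (∫ U, Y U ∂(wilsonMeasure ρ β)) ^ 2)
        - 2 * ((∫ U, Y U.negReflect * X U ∂(wilsonMeasure ρ β)) -
            (∫ U, Y U ∂(wilsonMeasure ρ β)) * (∫ U, X U ∂(wilsonMeasure ρ β)))
        + ((∫ U, X U.negReflect * X U ∂(wilsonMeasure ρ β)) - (∫ U, X U ∂(wilsonMeasure ρ β)) ^ 2) := by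
  haveI := isProbabilityMeasure_wilsonMeasure (d := 4) (L := T) ρ hρ β
  set μ : Measure (GaugeConfig 4 T G) := wilsonMeasure (d := 4) (L := T) ρ β with hμ
  have hϑ : Measurable (GaugeConfig.negReflect : GaugeConfig 4 T G → GaugeConfig 4 T G) :=
    WilsonSiteRP.measurable_negReflect
  -- integrability of everything in sight
  have bdd_mul : ∀ {f g : GaugeConfig 4 T G → ℝ} {Mf Mg : ℝ}, (∀ U, |f U| ≤ Mf) → (∀ U, |g U| ≤ Mg) →
      ∃ K : ℝ, ∀ U, |f U * g U| ≤ K := fun {f g Mf Mg} hf hg =>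
    ⟨Mf * Mg, fun U => by
      rw [abs_mul]; exact mul_le_mul (hf U) (hg U) (abs_nonneg _) ((abs_nonneg _).trans (hf U))⟩
  set Z : GaugeConfig 4 T G → ℝ := fun U => X U - Y U with hZ
  have hZm : Measurable Z := hX.sub hY
  have bZ : ∀ U, |Z U| ≤ MX + MY := fun U => by
    simp only [hZ]; exact (abs_sub _ _).trans (add_le_add (bX U) (bY U))
  have iX : Integrable X μ := integrable_wilson_of_bdd ρ hρ β hX ⟨MX, bX⟩
  have iY : Integrable Y μ := integrable_wilson_of_bdd ρ hρ β hY ⟨MY, bY⟩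
  have iZ : Integrable Z μ := integrable_wilson_of_bdd ρ hρ β hZm ⟨MX + MY, bZ⟩
  have iZϑ : Integrable (fun U => Z U.negReflect) μ :=
    integrable_wilson_of_bdd ρ hρ β (hZm.comp hϑ) ⟨MX + MY, fun U => bZ _⟩
  have iZZ : Integrable (fun U => Z U.negReflect * Z U) μ :=
    integrable_wilson_of_bdd ρ hρ β ((hZm.comp hϑ).mul hZm) (bdd_mul (fun U => bZ _) bZ)
  have iXX : Integrable (fun U => X U.negReflect * X U) μ :=
    integrable_wilson_of_bdd ρ hρ β ((hX.comp hϑ).mul hX) (bdd_mul (fun U => bX _) bX)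
  have iXY : Integrable (fun U => X U.negReflect * Y U) μ :=
    integrable_wilson_of_bdd ρ hρ β ((hX.comp hϑ).mul hY) (bdd_mul (fun U => bX _) bY)
  have iYX : Integrable (fun U => Y U.negReflect * X U) μ :=
    integrable_wilson_of_bdd ρ hρ β ((hY.comp hϑ).mul hX) (bdd_mul (fun U => bY _) bX)
  have iYY : Integrable (fun U => Y U.negReflect * Y U) μ :=
    integrable_wilson_of_bdd ρ hρ β ((hY.comp hϑ).mul hY) (bdd_mul (fun U => bY _) bY)
  -- reflection invariance of the mean of `Z` and symmetry of the mixed term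
  have hZϑ : ∫ U, Z U.negReflect ∂μ = ∫ U, Z U ∂μ := integral_comp_negReflect_eq (d := 4) (L := T) ρ hρ β Z
  have hsym : ∫ U, X U.negReflect * Y U ∂μ = ∫ U, Y U.negReflect * X U ∂μ := by
    have h := integral_comp_negReflect_eq (d := 4) (L := T) ρ hρ β (fun U => Y U.negReflect * X U)
    simp only [WilsonSiteRP.negReflect_negReflect_config] at h
    rw [← h]
    exact integral_congr_ae (ae_of_all _ fun U => mul_comm _ _)
  -- step 1: reduce to `Z`:  `B(Z + p, Z + p) = B(Z, Z)`
  have e1 : (fun U => (X U.negReflect - Y U.negReflect + p) * (X U - Y U + p)) =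
      fun U => (Z U.negReflect * Z U + p * Z U) + (p * Z U.negReflect + p * p) := by
    funext U; simp only [hZ]; ring
  have e1' : (fun U => X U - Y U + p) = fun U => Z U + p := by funext U; simp only [hZ]
  have hint1 : ∫ U, (X U.negReflect - Y U.negReflect + p) * (X U - Y U + p) ∂μ =
      (∫ U, Z U.negReflect * Z U ∂μ) + 2 * p * (∫ U, Z U ∂μ) + p * p := by
    have i1 : Integrable (fun U => Z U.negReflect * Z U + p * Z U) μ := iZZ.add (iZ.const_mul p)
    have i2 : Integrable (fun U => p * Z U.negReflect + p * p) μ := (iZϑ.const_mul p).add (integrable_const _)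
    have i3 : Integrable (fun U => p * Z U) μ := iZ.const_mul p
    have i4 : Integrable (fun U => p * Z U.negReflect) μ := iZϑ.const_mul p
    rw [e1, integral_add i1 i2, integral_add iZZ i3, integral_add i4 (integrable_const _),
      integral_const_mul, integral_const_mul, hZϑ, integral_const, smul_eq_mul, probReal_univ]
    ring
  have hmean : ∫ U, (X U - Y U + p) ∂μ = (∫ U, Z U ∂μ) + p := by
    rw [e1', integral_add iZ (integrable_const _), integral_const, smul_eq_mul, probReal_univ]
    ring
  -- step 2: expand `B(Z, Z)` along `Z = X − Y`
  have e2 : (fun U => Z U.negReflect * Z U) =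
      fun U => (X U.negReflect * X U - X U.negReflect * Y U) - (Y U.negReflect * X U - Y U.negReflect * Y U) := by
    funext U; simp only [hZ]; ring
  have hint2 : ∫ U, Z U.negReflect * Z U ∂μ =
      (∫ U, X U.negReflect * X U ∂μ) - 2 * (∫ U, Y U.negReflect * X U ∂μ) + (∫ U, Y U.negReflect * Y U ∂μ) := by
    have i1 : Integrable (fun U => X U.negReflect * X U - X U.negReflect * Y U) μ := iXX.sub iXY
    have i2 : Integrable (fun U => Y U.negReflect * X U - Y U.negReflect * Y U) μ := iYX.sub iYY
    rw [e2, integral_sub i1 i2, integral_sub iXX iXY, integral_sub iYX iYY, hsym]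
    ring
  have hmeanZ : ∫ U, Z U ∂μ = (∫ U, X U ∂μ) - (∫ U, Y U ∂μ) := by
    simp only [hZ]; exact integral_sub iX iY
  rw [hint1, hmean, hint2, hmeanZ]
  ring

/-- **The diagonal of the mirror form is below the sup-norm squared**: `B(D, D) ≤ (sup |D|)²`, indeed
`∫ D∘ϑ · D − (∫D)² ≤ ∫ |D∘ϑ| |D| ≤ K²` for `|D| ≤ K`. [folklore] -/
theorem mirrorForm_le_sq (hρ : Continuous ρ) (β : ℝ) {D : GaugeConfig 4 T G → ℝ} (hD : Measurable D) {K : ℝ}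
    (bD : ∀ U, |D U| ≤ K) :
    (∫ U, D U.negReflect * D U ∂(wilsonMeasure ρ β)) - (∫ U, D U ∂(wilsonMeasure ρ β)) ^ 2 ≤ K ^ 2 := by
  haveI := isProbabilityMeasure_wilsonMeasure (d := 4) (L := T) ρ hρ β
  have hϑ : Measurable (GaugeConfig.negReflect : GaugeConfig 4 T G → GaugeConfig 4 T G) :=
    WilsonSiteRP.measurable_negReflect
  have hK : 0 ≤ K := (abs_nonneg _).trans (bD (fun _ => 1))
  have hle : ∀ U, D U.negReflect * D U ≤ K ^ 2 := fun U =>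
    calc D U.negReflect * D U ≤ |D U.negReflect * D U| := le_abs_self _
      _ = |D U.negReflect| * |D U| := abs_mul _ _
      _ ≤ K * K := mul_le_mul (bD _) (bD _) (abs_nonneg _) hK
      _ = K ^ 2 := by ring
  have iDD : Integrable (fun U => D U.negReflect * D U) (wilsonMeasure (d := 4) (L := T) ρ β) :=
    integrable_wilson_of_bdd ρ hρ β ((hD.comp hϑ).mul hD) ⟨K * K, fun U => by
      rw [abs_mul]; exact mul_le_mul (bD _) (bD _) (abs_nonneg _) hK⟩
  have h1 : ∫ U, D U.negReflect * D U ∂(wilsonMeasure ρ β) ≤ K ^ 2 :=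
    calc ∫ U, D U.negReflect * D U ∂(wilsonMeasure ρ β)
        ≤ ∫ _U, K ^ 2 ∂(wilsonMeasure (d := 4) (L := T) ρ β) := integral_mono iDD (integrable_const _) hle
      _ = K ^ 2 := by rw [integral_const, smul_eq_mul, probReal_univ, one_mul]
  nlinarith [sq_nonneg (∫ U, D U ∂(wilsonMeasure (d := 4) (L := T) ρ β))]

end Form

/-! ## §4 The mirror floor transfer at one coupling on one torus -/

section Floor

variable (G : Type) [Group G] [TopologicalSpace G] [IsTopologicalGroup G] [CompactSpace G]
  [MeasurableSpace G] [BorelSpace G] (r : LatticeRep G)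

/-- **Mirror floor transfer (card E, Mechanism 1–5, at fixed `β ≥ 0` on the torus of side `2L+1`).**
A cube `Q = (c, b)` at times `≥ 1` with its closed collar inside the window (`c 0 + b + 3 ≤ L`, `−L + 2 ≤ c j`,
`c j + b + 2 ≤ L + 1`); `W` a bounded continuous cylinder observable with links based in `[c, c + b]`; `𝒢` a bounded
continuous cylinder functional with links based in `[c − 1, c + b + 1]` (the closed collar); a reference value `p`
and `ε > 0` such that
(RBL+SUP) `|kerE_Q^ζ(W) − p + 𝒢 ζ| ≤ √ε/2` for every exterior `ζ`, and
(SF) `4ε ≤ Cov_T(𝒢∘Θ₀, 𝒢)` (read through the periodic lift).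
Then `9ε/4 ≤ Cov_T(W∘Θ₀, W)`.  In the application `W = Ṽ_v` is the smeared action density carried by one
positive-time femto cube, `p = p_Q(β)`, `𝒢 = 𝒢_v` the `v`-weighted classical Dirichlet excess energy of the boundary
data, and `Cov_T(W∘Θ₀, W)` differs from `Q2(θv, v)` by the `ShiftCeiling` term `O(a(β))`. [folklore] -/
theorem mirrorCov_ge_of_boundaryResponse {β : ℝ} (hβ : 0 ≤ β) (c : Fin 4 → ℤ) (b L : ℕ) (hc0 : 1 ≤ c 0)
    (hcL : c 0 + (b : ℤ) + 3 ≤ L) (hc : ∀ j, -(L : ℤ) + 2 ≤ c j ∧ c j + (b : ℤ) + 2 ≤ (L : ℤ) + 1)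
    {W : LGConfig 4 G → ℝ} (hWc : Continuous W) {MW : ℝ} (hMW : ∀ U, |W U| ≤ MW)
    {SW : Finset (Literature.MathematicalPhysics.QuantumLattice.ZdEdge 4)} (hWS : IsCylinder W SW)
    (hSW : ∀ e ∈ SW, ∀ j, c j ≤ e.1 j ∧ e.1 j ≤ c j + b)
    {𝒢 : LGConfig 4 G → ℝ} (h𝒢c : Continuous 𝒢) {M𝒢 : ℝ} (hM𝒢 : ∀ U, |𝒢 U| ≤ M𝒢)
    {S𝒢 : Finset (Literature.MathematicalPhysics.QuantumLattice.ZdEdge 4)} (h𝒢S : IsCylinder 𝒢 S𝒢)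
    (hS𝒢 : ∀ e ∈ S𝒢, ∀ j, c j - 1 ≤ e.1 j ∧ e.1 j ≤ c j + b + 1)
    {p ε : ℝ} (hε : 0 < ε)
    (hd : ∀ ζ, |kerE G r β c b ζ W - p + 𝒢 ζ| ≤ Real.sqrt ε / 2)
    (hSF : 4 * ε ≤ torusE G r β L (fun V => 𝒢 (cfgReflect V) * 𝒢 V) -
      torusE G r β L (fun V => 𝒢 (cfgReflect V)) * torusE G r β L 𝒢) :
    9 * ε / 4 ≤ torusE G r β L (fun V => W (cfgReflect V) * W V) -
      torusE G r β L (fun V => W (cfgReflect V)) * torusE G r β L W := by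
  classical
  haveI := r.secondCountableTopology
  haveI := isProbabilityMeasure_wilsonMeasure (d := 4) (L := 2 * L + 1) r.ρ r.continuous β
  -- the three torus observables: boundary response `m`, shell `Gt`, remainder `D`
  set m : GaugeConfig 4 (2 * L + 1) G → ℝ := fun U => kerE G r β c b (torusLift (2 * L + 1) U) W with hm
  set Gt : GaugeConfig 4 (2 * L + 1) G → ℝ := fun U => 𝒢 (torusLift (2 * L + 1) U) with hGt
  set D : GaugeConfig 4 (2 * L + 1) G → ℝ := fun U => m U - p + Gt U with hD
  -- regularity
  have hmc : Continuous m := continuous_kerE_torusLift G r β c b (2 * L + 1) hWc hMW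
  have hmb : ∀ U, |m U| ≤ MW := fun U => abs_kerE_le G r β c b _ hMW
  have hGtc : Continuous Gt := h𝒢c.comp (continuous_torusLift _)
  have hGtb : ∀ U, |Gt U| ≤ M𝒢 := fun U => hM𝒢 _
  have hDc : Continuous D := (hmc.sub continuous_const).add hGtc
  have hDb : ∀ U, |D U| ≤ Real.sqrt ε / 2 := fun U => hd _
  -- non-negative-half dependence of `Gt` and `D` (for reflection positivity)
  have hposG : DependsOn Gt {e : Edge 4 (2 * L + 1) | (e.1 0).val ≤ L ∧ ((e.1.shift e.2) 0).val ≤ L} :=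
    dependsOn_posHalf_of_window L h𝒢S fun e he => ⟨by linarith [(hS𝒢 e he 0).1], by linarith [(hS𝒢 e he 0).2]⟩
  have hposm : DependsOn m {e : Edge 4 (2 * L + 1) | (e.1 0).val ≤ L ∧ ((e.1.shift e.2) 0).val ≤ L} :=
    dependsOn_posHalf_of_window L (isCylinder_kerE G r β c b hWc.measurable hWS) fun e he => by
      have := kerE_supp_window hSW he 0
      constructor <;> linarith [this.1, this.2]
  have hposD : DependsOn D {e : Edge 4 (2 * L + 1) | (e.1 0).val ≤ L ∧ ((e.1.shift e.2) 0).val ≤ L} :=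
    fun U V hUV => by simp only [hD, hposm hUV, hposG hUV]
  have hL1 : 1 ≤ L := by linarith
  -- (3) reflection-positivity Cauchy–Schwarz for the pair `(Gt, D)`
  have hcs := sq_cov_negReflect_le_odd_pos (d := 4) (L := 2 * L + 1) r.ρ rfl hL1 r.continuous hβ
    hGtc.measurable hDc.measurable ⟨M𝒢, hGtb⟩ ⟨Real.sqrt ε / 2, hDb⟩ hposG hposD
  -- (2) expansion of `B(m, m)` along `m = D − Gt + p`
  have hexp := mirrorForm_expand (T := 2 * L + 1) r.ρ r.continuous β hDc.measurable hGtc.measurable hDb hGtb p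
  have em : ∀ U, m U = D U - Gt U + p := fun U => by simp only [hD]; ring
  -- (4) the remainder's diagonal entry is small
  have hdd := mirrorForm_le_sq (T := 2 * L + 1) r.ρ r.continuous β hDc.measurable hDb
  have hdd' : (∫ U, D U.negReflect * D U ∂(wilsonMeasure (d := 4) (L := 2 * L + 1) r.ρ β)) -
      (∫ U, D U ∂(wilsonMeasure (d := 4) (L := 2 * L + 1) r.ρ β)) ^ 2 ≤ ε / 4 := by
    rw [div_pow, Real.sq_sqrt hε.le] at hdd
    linarith
  -- (1) the mirror factorisation, in `ϑ`-coordinates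
  have hfac := torusCov_reflect_lift_eq_torusCov_reflect_kerE G r β c b L hc0 hcL hc hWc hWc hMW hMW hWS hWS hSW hSW
  have hinvm : ∫ U, m U.negReflect ∂(wilsonMeasure (d := 4) (L := 2 * L + 1) r.ρ β) =
      ∫ U, m U ∂(wilsonMeasure (d := 4) (L := 2 * L + 1) r.ρ β) :=
    integral_comp_negReflect_eq (d := 4) (L := 2 * L + 1) r.ρ r.continuous β m
  have hinvG : ∫ U, Gt U.negReflect ∂(wilsonMeasure (d := 4) (L := 2 * L + 1) r.ρ β) =
      ∫ U, Gt U ∂(wilsonMeasure (d := 4) (L := 2 * L + 1) r.ρ β) :=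
    integral_comp_negReflect_eq (d := 4) (L := 2 * L + 1) r.ρ r.continuous β Gt
  -- assemble
  unfold torusE at hfac hSF ⊢
  simp only [← torusLift_negReflect] at hfac hSF ⊢
  rw [hfac]
  change 9 * ε / 4 ≤ (∫ U, m U.negReflect * m U ∂(wilsonMeasure (d := 4) (L := 2 * L + 1) r.ρ β)) -
    (∫ U, m U.negReflect ∂(wilsonMeasure (d := 4) (L := 2 * L + 1) r.ρ β)) *
      (∫ U, m U ∂(wilsonMeasure (d := 4) (L := 2 * L + 1) r.ρ β))
  change 4 * ε ≤ (∫ U, Gt U.negReflect * Gt U ∂(wilsonMeasure (d := 4) (L := 2 * L + 1) r.ρ β)) -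
    (∫ U, Gt U.negReflect ∂(wilsonMeasure (d := 4) (L := 2 * L + 1) r.ρ β)) *
      (∫ U, Gt U ∂(wilsonMeasure (d := 4) (L := 2 * L + 1) r.ρ β)) at hSF
  rw [hinvm]
  rw [hinvG] at hSF
  have hmm : (∫ U, m U.negReflect * m U ∂(wilsonMeasure (d := 4) (L := 2 * L + 1) r.ρ β)) -
      (∫ U, m U ∂(wilsonMeasure (d := 4) (L := 2 * L + 1) r.ρ β)) *
        (∫ U, m U ∂(wilsonMeasure (d := 4) (L := 2 * L + 1) r.ρ β)) =
      (∫ U, (D U.negReflect - Gt U.negReflect + p) * (D U - Gt U + p) ∂(wilsonMeasure (d := 4) (L := 2 * L + 1) r.ρ β)) -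
        (∫ U, (D U - Gt U + p) ∂(wilsonMeasure (d := 4) (L := 2 * L + 1) r.ρ β)) ^ 2 := by
    simp only [← em, sq]
  rw [hmm, hexp]
  exact mirror_floor_arith rfl hcs (by nlinarith [hSF]) hdd' hε

end Floor

end Summit.QuantumFields.YangMills.Cruxes.NT.MarkovMirror

end
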